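import Summits.Ventures.HSemireg.ObstructionLocusBlockDevissage

/-!
# Venture HSemireg — (S5) OBSTRUCTION LOCUS away from secant type, XXVIII: the dévissage as a SHORT EXACT SEQUENCE
# in `ModuleCat R`, and the two `Ext` inputs of the induction step of the Künneth-free proof of EXT-NOTE §6.B(b)

HONEST FRAMING.  Part of the Lean side of the computation cell `pub-hsemireg` (track «S4-PUSH» (ii), seat
s4-prove-2; files XXVII–XXIX, see the module docstring of file XXVII `ObstructionLocusBlockDevissage` for the whole
argument).  Plain commutative / homological algebra in `R = MvPolynomial (Fin n) K`, every `n`, EVERY commutative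
ring `K`, with Mathlib's derived `CategoryTheory.Abelian.Ext` in `ModuleCat R` (file XXV's calculus: long exact
sequences `Ext.contravariant_sequence_exact₁/₃`, `covariant_sequence_exact₁`, the extension class
`ShortComplex.ShortExact.extClass`, projective vanishing `Ext.eq_zero_of_projective`, `R`-linearity).  Nothing here
constructs a variety or a sheaf; nothing here says that HC / HC_CM / HC_AV holds; no Literature fact is declared or
used; no object is certified.

* `hbMap_single` (`Φ_V(v·e_b) = x_b v·e_b − x_{a₀} v·e_{a₀}`), `sum_smul_proj_single`, `hbMap_compLeft_inclusion`
  (naturality of `Φ_V` in `V`), `compLeft_inclusion_single` — evaluation lemmas for STEPS 3–4;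
* **`devissage S V ha₀`** — the short complex `V^{S∖a₀} →Φ_V V^S →E I_S ∩ V` in `ModuleCat R`, and
  **`devissage_shortExact`** (file XXVII's exactness, injectivity, surjectivity);
* `ext_comp_subtype_eq_zero_top` — the base of the induction (`V = R`: `Ext¹_R(R, −) = 0`);
  **`delta_surjective_of_ext_comp_subtype_eq_zero`** — `ι_* = 0` on `Ext¹_R(J, J)` ⟹ file XXV's `δ` is onto;
* **`pi_ext_comp_subtype_eq_zero`** (STEP 1): if `ι_{V*} = 0` on `Ext¹_R(V, V)` then `ζ ∘ [ι_V] = 0` for every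
  `ζ ∈ Ext¹_R(V^S, V)` (decompose along `𝟙 = Σ_a ι_a ∘ pr_a`, `Ext.mk₀_sum`, `Ext.sum_comp`);
* **`exists_comp_hbMap_eq_smul_proj`** (STEP 4): for `u ∈ I_S` and `b ∈ S ∖ a₀`, the functional `u·pr_b` on
  `R^{S∖a₀}` factors through `Φ_R : R^{S∖a₀} → R^S` — its image under the connecting map of the dévissage with
  `V = R` is `u · ∂(pr_b) ∈ I_S · Ext¹_R(I_S, R) = 0` (file XXV's `smul_ext_eq_zero_of_mem`).
References (dictionary only): EXT-NOTE.md §6.A, §6.B(b); G2-REDUCIBLE-POINT-THEOREM.md §2 L1 (ii).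
-/

open CategoryTheory CategoryTheory.Abelian MvPolynomial Finset
open scoped BigOperators

universe u

namespace Summit.Ventures.HSemireg.ObstructionLocus.BlockModel

variable {K : Type u} [CommRing K] {n : ℕ}

/-! ## Evaluation of `Φ_V` on the unit vectors; naturality in `V` -/

section Algebra

variable (S : Finset (Fin n)) {a₀ : Fin n} (ha₀ : a₀ ∈ S) (V : Ideal (MvPolynomial (Fin n) K))

/-- `Φ_V(v · e_b) = x_b v · e_b − x_{a₀} v · e_{a₀}`. -/
theorem hbMap_single (b : ↥(S.erase a₀)) (v : ↥V) :
    hbMap S a₀ V (Pi.single b v) =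
      Pi.single (⟨b.1, Finset.mem_of_mem_erase b.2⟩ : ↥S) ((X b.1 : MvPolynomial (Fin n) K) • v)
        - Pi.single (⟨a₀, ha₀⟩ : ↥S) ((X a₀ : MvPolynomial (Fin n) K) • v) := by
  classical
  have hb : (b : Fin n) ≠ a₀ := (Finset.mem_erase.1 b.2).1
  have hne : (⟨a₀, ha₀⟩ : ↥S) ≠ ⟨b.1, Finset.mem_of_mem_erase b.2⟩ :=
    fun h' => hb (congr_arg Subtype.val h').symm
  funext a
  rw [Pi.sub_apply]
  by_cases h : (a : Fin n) = a₀
  · have ha : a = ⟨a₀, ha₀⟩ := Subtype.ext h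
    rw [hbMap_apply_of_eq S a₀ V _ a h, ha, Pi.single_eq_same, Pi.single_eq_of_ne hne, zero_sub,
      Finset.sum_pi_single' b v, if_pos (Finset.mem_univ b)]
  · have hne2 : a ≠ ⟨a₀, ha₀⟩ := fun h' => h (congr_arg Subtype.val h')
    rw [hbMap_apply_of_ne S a₀ V _ a h, Pi.single_eq_of_ne hne2, sub_zero]
    by_cases hab : (⟨a.1, Finset.mem_erase.2 ⟨h, a.2⟩⟩ : ↥(S.erase a₀)) = b
    · have : a = ⟨b.1, Finset.mem_of_mem_erase b.2⟩ :=
        Subtype.ext (by have h1 := congr_arg Subtype.val hab; exact h1)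
      rw [hab, Pi.single_eq_same, this, Pi.single_eq_same]
    · have hab' : a ≠ ⟨b.1, Finset.mem_of_mem_erase b.2⟩ :=
        fun h' => hab (Subtype.ext (by have h1 := congr_arg Subtype.val h'; exact h1))
      rw [Pi.single_eq_of_ne hab, smul_zero, Pi.single_eq_of_ne hab']

/-- The coefficient form `ψ₀ = Σ_a c_a · pr_a : V^S → R` evaluated on a unit vector. -/
theorem sum_smul_proj_single (c : ↥S → MvPolynomial (Fin n) K) (a : ↥S) (v : ↥V) :
    (∑ a' : ↥S, c a' • (V.subtype ∘ₗ LinearMap.proj a')) (Pi.single a v)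
      = c a * (v : MvPolynomial (Fin n) K) := by
  classical
  rw [LinearMap.sum_apply, Finset.sum_eq_single a]
  · simp
  · intro a' _ ha'
    simp [Pi.single_eq_of_ne ha']
  · intro h; exact absurd (Finset.mem_univ a) h

variable {V} in
/-- Naturality of `Φ` in `V`: for `V ≤ V'`, `Φ_{V'} ∘ incl = incl ∘ Φ_V`. -/
theorem hbMap_compLeft_inclusion {V' : Ideal (MvPolynomial (Fin n) K)} (hVV' : V ≤ V')
    (w : ↥(S.erase a₀) → ↥V) :
    hbMap S a₀ V' ((Submodule.inclusion hVV').compLeft ↥(S.erase a₀) w)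
      = (Submodule.inclusion hVV').compLeft ↥S (hbMap S a₀ V w) := by
  funext a
  apply Subtype.ext
  rw [LinearMap.compLeft_apply, Function.comp_apply, Submodule.coe_inclusion, hbMap_apply_coe,
    hbMap_apply_coe]
  congr 1

/-- `incl ∘ (v · e_b) = (incl v) · e_b`. -/
theorem compLeft_inclusion_single {V' : Ideal (MvPolynomial (Fin n) K)} (hVV' : V ≤ V')
    {α : Type*} [DecidableEq α] (b : α) (v : ↥V) :
    (Submodule.inclusion hVV').compLeft α (Pi.single b v) = Pi.single b (Submodule.inclusion hVV' v) := by
  funext a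
  rw [LinearMap.compLeft_apply, Function.comp_apply]
  by_cases h : a = b
  · subst h; rw [Pi.single_eq_same, Pi.single_eq_same]
  · rw [Pi.single_eq_of_ne h, Pi.single_eq_of_ne h, map_zero]

end Algebra

/-! ## The dévissage as a short exact sequence in `ModuleCat R` -/

section SES

variable (S : Finset (Fin n)) {a₀ : Fin n} (V : Ideal (MvPolynomial (Fin n) K))

/-- **The dévissage short complex `V^{S∖a₀} →Φ_V V^S →E I_S ∩ V`** in `ModuleCat R`. -/
noncomputable abbrev devissage (ha₀ : a₀ ∈ S) : ShortComplex (ModuleCat.{u} (MvPolynomial (Fin n) K)) :=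
  ModuleCat.shortComplexOfCompEqZero (hbMap S a₀ V) (gsMap S V)
    (LinearMap.ext fun w => gsMap_hbMap V ha₀ w)

/-- **It is short exact** when the `x_a`, `a ∈ S`, are non-zero-divisors modulo `V` and `I_S ∩ V ⊆ I_S · V`. -/
theorem devissage_shortExact (ha₀ : a₀ ∈ S)
    (hV : ∀ a ∈ S, ∀ s : MvPolynomial (Fin n) K, X a * s ∈ V → s ∈ V)
    (hUV : blockIdeal K S ⊓ V ≤ blockIdeal K S * V) : (devissage S V ha₀).ShortExact :=
  ModuleCat.shortComplex_shortExact _ (exact_hbMap_gsMap ha₀ hV) (hbMap_injective S a₀ V)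
    (gsMap_surjective hUV)

end SES

/-! ## The vanishing `ι_* = 0` on `Ext¹_R(J, J)` and the surjectivity of `δ` -/

/-- The unit ideal: `Ext¹_R(R, −) = 0`, so `ι_* = 0` on `Ext¹_R(R, R)` trivially (base of the induction). -/
theorem ext_comp_subtype_eq_zero_top
    (e : Ext.{u} (ModuleCat.of (MvPolynomial (Fin n) K) ↥(⊤ : Ideal (MvPolynomial (Fin n) K)))
      (ModuleCat.of (MvPolynomial (Fin n) K) ↥(⊤ : Ideal (MvPolynomial (Fin n) K))) 1) :
    e.comp (Ext.mk₀ (ModuleCat.ofHom (⊤ : Ideal (MvPolynomial (Fin n) K)).subtype)) (add_zero 1) = 0 := by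
  haveI : Module.Projective (MvPolynomial (Fin n) K) ↥(⊤ : Ideal (MvPolynomial (Fin n) K)) :=
    Module.Projective.of_equiv (Submodule.topEquiv.symm :
      MvPolynomial (Fin n) K ≃ₗ[MvPolynomial (Fin n) K] ↥(⊤ : Ideal (MvPolynomial (Fin n) K)))
  rw [Ext.eq_zero_of_projective e, Ext.zero_comp]

/-- **`ι_* = 0` on `Ext¹_R(J, J)` ⟹ `δ : Hom_R(J, R/J) → Ext¹_R(J, J)` onto** (exactness of
`Hom(J, R/J) → Ext¹(J, J) → Ext¹(J, R)`, file XXV's `delta`; the converse also holds). -/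
theorem delta_surjective_of_ext_comp_subtype_eq_zero {J : Ideal (MvPolynomial (Fin n) K)}
    (hJ : ∀ e : Ext.{u} (ModuleCat.of (MvPolynomial (Fin n) K) ↥J) (ModuleCat.of (MvPolynomial (Fin n) K) ↥J) 1,
      e.comp (Ext.mk₀ (ModuleCat.ofHom J.subtype)) (add_zero 1) = 0) :
    Function.Surjective (delta J) := by
  intro e
  obtain ⟨x₃, hx₃⟩ := Ext.covariant_sequence_exact₁ (ModuleCat.of (MvPolynomial (Fin n) K) ↥J)
    (quotSES_shortExact J) e (hJ e) (zero_add 1)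
  obtain ⟨φ, rfl⟩ := (Ext.mk₀_bijective _ _).2 x₃
  exact ⟨φ.hom, hx₃⟩

/-! ## Input 1 of the induction step: `Ext¹(V^S, V) → Ext¹(V^S, R)` vanishes when `ι_{V*} = 0` -/

/-- If `ι_{V*} = 0` on `Ext¹_R(V, V)`, then also on `Ext¹_R(V^S, V)` (decompose along `id = Σ_a ι_a ∘ pr_a`). -/
theorem pi_ext_comp_subtype_eq_zero {V : Ideal (MvPolynomial (Fin n) K)}
    (hP : ∀ e : Ext.{u} (ModuleCat.of (MvPolynomial (Fin n) K) ↥V) (ModuleCat.of (MvPolynomial (Fin n) K) ↥V) 1,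
      e.comp (Ext.mk₀ (ModuleCat.ofHom V.subtype)) (add_zero 1) = 0)
    (S : Finset (Fin n))
    (ζ : Ext.{u} (ModuleCat.of (MvPolynomial (Fin n) K) (↥S → ↥V)) (ModuleCat.of (MvPolynomial (Fin n) K) ↥V) 1) :
    ζ.comp (Ext.mk₀ (ModuleCat.ofHom V.subtype)) (add_zero 1) = 0 := by
  classical
  have hid : (𝟙 (ModuleCat.of (MvPolynomial (Fin n) K) (↥S → ↥V))) =
      ∑ a : ↥S, ModuleCat.ofHom (LinearMap.proj a) ≫
        ModuleCat.ofHom (LinearMap.single (MvPolynomial (Fin n) K) (fun _ : ↥S => ↥V) a) := by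
    apply ModuleCat.hom_ext
    rw [ModuleCat.hom_id, ModuleCat.hom_sum]
    apply LinearMap.ext
    intro x
    rw [LinearMap.id_apply, LinearMap.sum_apply]
    conv_lhs => rw [← Finset.univ_sum_single x]
    refine Finset.sum_congr rfl fun a _ => ?_
    rfl
  rw [← Ext.mk₀_id_comp ζ, hid, Ext.mk₀_sum, Ext.sum_comp, Ext.sum_comp]
  refine Finset.sum_eq_zero fun a _ => ?_
  rw [← Ext.mk₀_comp_mk₀, Ext.comp_assoc_of_second_deg_zero, Ext.comp_assoc_of_third_deg_zero, hP,
    Ext.comp_zero]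

/-! ## Input 2 of the induction step: `u · pr_b ∈ im Φ^*` for `u ∈ I_S` (the dévissage with `V = R`) -/

/-- For `u ∈ I_S` and `b ∈ S ∖ a₀`, the functional `w ↦ u · w_b` on `R^{S∖a₀}` factors through the Hilbert–Burch
map `Φ_R : R^{S∖a₀} → R^S` — because its image under the connecting map of `0 → R^{S∖a₀} → R^S → I_S → 0` is
`u · ∂(pr_b) ∈ I_S · Ext¹_R(I_S, R) = 0` (file XXV's `smul_ext_eq_zero_of_mem`). -/
theorem exists_comp_hbMap_eq_smul_proj (S : Finset (Fin n)) {a₀ : Fin n} (ha₀ : a₀ ∈ S)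
    {u : MvPolynomial (Fin n) K} (hu : u ∈ blockIdeal K S) (b : ↥(S.erase a₀)) :
    ∃ Ψ : (↥S → ↥(⊤ : Ideal (MvPolynomial (Fin n) K))) →ₗ[MvPolynomial (Fin n) K] MvPolynomial (Fin n) K,
      Ψ ∘ₗ hbMap S a₀ (⊤ : Ideal (MvPolynomial (Fin n) K)) = u • ((⊤ : Ideal (MvPolynomial (Fin n) K)).subtype ∘ₗ LinearMap.proj b) := by
  have hT := devissage_shortExact S (⊤ : Ideal (MvPolynomial (Fin n) K)) ha₀ (X_mul_mem_top_imp S)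
    (blockIdeal_inf_top_le_mul S)
  set crd : (↥(S.erase a₀) → ↥(⊤ : Ideal (MvPolynomial (Fin n) K))) →ₗ[MvPolynomial (Fin n) K]
      MvPolynomial (Fin n) K := (⊤ : Ideal (MvPolynomial (Fin n) K)).subtype ∘ₗ LinearMap.proj b with hcrd
  have hu' : u ∈ blockIdeal K S ⊓ (⊤ : Ideal (MvPolynomial (Fin n) K)) := by
    rw [inf_top_eq]; exact hu
  have h0 : hT.extClass.comp (Ext.mk₀ (ModuleCat.ofHom (u • crd))) (show 1 + 0 = 1 by rfl) = 0 := by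
    have : ModuleCat.ofHom (u • crd) = u • ModuleCat.ofHom crd := rfl
    rw [this, Ext.mk₀_smul, Ext.comp_smul]
    exact smul_ext_eq_zero_of_mem _ hu' _
  obtain ⟨x₂, hx₂⟩ := Ext.contravariant_sequence_exact₁ hT
    (ModuleCat.of (MvPolynomial (Fin n) K) (MvPolynomial (Fin n) K)) _ (show 1 + 0 = 1 by rfl) h0
  obtain ⟨Ψ, rfl⟩ := (Ext.mk₀_bijective _ _).2 x₂
  rw [Ext.mk₀_comp_mk₀] at hx₂
  have h := (Ext.mk₀_bijective _ _).1 hx₂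
  refine ⟨Ψ.hom, ?_⟩
  have h' := congr_arg ModuleCat.Hom.hom h
  rw [ModuleCat.hom_comp] at h'
  exact h'

end Summit.Ventures.HSemireg.ObstructionLocus.BlockModel
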